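import Literature.AnabelianGeometry.SemiGraphs.UniversalCoveringOverDescent
import Literature.AnabelianGeometry.SemiGraphs.UniversalCoveringOverCountable
import Literature.AnabelianGeometry.SemiGraphs.TemperedGroupsLimit
import Mathlib.CategoryTheory.Conj
import Mathlib.Topology.Instances.Discrete

/-!
# The tempered fundamental group as a limit of `Gal(𝒢_{∞,i}/𝒢)` ([SemiAnbd] Prop. 3.6, p. 38)

Mochizuki, *Semi-graphs of anabelioids*, §3 p. 38: "we may choose compatible maps
`𝒢_{∞,j} → 𝒢_{∞,i}`, hence [surjections] `Gal(𝒢_{∞,j}/𝒢) → Gal(𝒢_{∞,i}/𝒢)`. Thus, we may define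
the tempered fundamental group `π₁^temp(𝒢) := lim_i Gal(𝒢_{∞,i}/𝒢)` … This topological group is
tempered" (Proposition 3.6 (i)).

Given *Galois level data* for `𝒢` — a tower `S 0 ⟵ S 1 ⟵ ⋯` of coverings with
point-transitive endomorphisms (e.g. a cofinal tower of connected finite étale Galois coverings) and
compatible base vertex-orbits — this file assembles the groups `G n := Aut(𝒢_{∞,S n})`
(`UniversalCoveringOver*.lean`: countable by rigidity, with surjective descent maps) into a
`CountableDiscreteSystem` (`TemperedGroupsLimit.lean`) and defines
`π₁^temp := lim_n G n` (`temperedPi`), which is TEMPERED (`isTempered_temperedPi`,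
Prop. 3.6 (i) for the constructed group).  The construction of Galois level data from the
hypotheses of Prop. 3.6 (via `galoisTower`, `galoisCategory_bFinCat`) is the object of a sequel.
-/

namespace Literature.AnabelianGeometry.SemiGraphs

namespace ProfiniteSemiGraph

open CategoryTheory

universe u

variable (𝒢 : ProfiniteSemiGraph.{u})

/-- **Galois level data** for `𝒢` ([SemiAnbd] p. 38: a cofinal tower of connected finite étale
Galois coverings `𝒢_i` with compatible maps; here: coverings with point-transitive endomorphisms
(e.g. Galois), transition maps, and compatible base vertex-orbits of their underlying semi-graphs).
[cite: MochizukiSemiAnbd2006, Prop 3.6 p.38] -/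
structure GaloisLevelData : Type (u + 1) where
  /-- the coverings `𝒢_n` -/
  S : ℕ → CovObj 𝒢
  /-- the transition maps `𝒢_{n+1} → 𝒢_n` -/
  g : ∀ n, S (n + 1) ⟶ S n
  /-- endomorphisms of `𝒢_n` act transitively on its fibres (Galois) -/
  htrans : ∀ n (v : 𝒢.graph.Vertex) (x x' : ((S n).SV v).obj.V),
    ∃ σ : S n ⟶ S n, (σ.fV v).hom.hom x = x'
  /-- the base vertex -/
  v₀ : 𝒢.graph.Vertex
  /-- compatible base points over `v₀` -/
  x : ∀ n, ((S n).SV v₀).obj.V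
  /-- compatibility of the base points -/
  hx : ∀ n, ((g n).fV v₀).hom.hom (x (n + 1)) = x n

namespace GaloisLevelData

variable {𝒢} (D : GaloisLevelData 𝒢) (h𝒢 : 𝒢.IsCountable)

/-- The base vertex-orbit `W n := [x n]` of `𝔾_{S n}`. [cite: MochizukiSemiAnbd2006, Prop 3.6 p.38] -/
def W (n : ℕ) : (D.S n).OVertex := Quot.mk _ ⟨D.v₀, D.x n⟩

/-- Compatibility of the base vertex-orbits. [cite: MochizukiSemiAnbd2006, Prop 3.6 p.38] -/
theorem hW (n : ℕ) : CovObj.OVertex.map (D.g n) (D.W (n + 1)) = D.W n := by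
  change (Quot.mk _ (⟨D.v₀, ((D.g n).fV D.v₀).hom.hom (D.x (n + 1))⟩ : Σ v, ((D.S n).SV v).obj.V) :
    (D.S n).OVertex) = Quot.mk _ ⟨D.v₀, D.x n⟩
  rw [D.hx n]

/-- The tempered covering `𝒢_{∞,n} := 𝒢_{∞, S n}` (based at `W n`). [cite: MochizukiSemiAnbd2006, Prop 3.6 p.38] -/
noncomputable def cover (n : ℕ) : CovObj 𝒢 := (D.S n).univCoverOver (Sum.inl (D.W n)) h𝒢

/-- `G_n := Gal(𝒢_{∞,n}/𝒢) = Aut(𝒢_{∞,n})`. [cite: MochizukiSemiAnbd2006, Prop 3.6 p.38] -/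
def Gal (n : ℕ) : Type u := Aut (D.cover h𝒢 n)

/-- Group structure on `G_n`. [cite: MochizukiSemiAnbd2006, Prop 3.6 p.38] -/
noncomputable instance (n : ℕ) : Group (D.Gal h𝒢 n) := inferInstanceAs (Group (Aut (D.cover h𝒢 n)))

/-- `G_n` carries the discrete topology. [cite: MochizukiSemiAnbd2006, Prop 3.6 p.38] -/
instance (n : ℕ) : TopologicalSpace (D.Gal h𝒢 n) := ⊥

/-- `G_n` is discrete. [cite: MochizukiSemiAnbd2006, Prop 3.6 p.38] -/
instance (n : ℕ) : DiscreteTopology (D.Gal h𝒢 n) := ⟨rfl⟩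

/-- `G_n` is countable (rigidity of `𝒢_{∞,n}`). [cite: MochizukiSemiAnbd2006, Prop 3.6 p.38] -/
theorem countable_Gal (n : ℕ) : Countable (D.Gal h𝒢 n) :=
  (D.S n).countable_aut_univCoverOver _ h𝒢 (CovObj.basePt (D.W n))

/-- The identification of `𝒢_{∞,S n}` based at `ḡ_n W_{n+1}` with `𝒢_{∞,n}` (based at `W n`).
[cite: MochizukiSemiAnbd2006, Prop 3.6 p.38] -/
noncomputable def baseIso (n : ℕ) :
    (D.S n).univCoverOver (Sum.inl (CovObj.OVertex.map (D.g n) (D.W (n + 1)))) h𝒢 ≅ D.cover h𝒢 n :=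
  eqToIso (congrArg (fun V => (D.S n).univCoverOver (Sum.inl V) h𝒢) (D.hW n))

/-- The transition homomorphism `G_{n+1} → G_n` (descent of automorphisms along
`𝒢_{∞,n+1} → 𝒢_{∞,n}`). [cite: MochizukiSemiAnbd2006, Prop 3.6 p.38] -/
noncomputable def step (n : ℕ) : D.Gal h𝒢 (n + 1) →* D.Gal h𝒢 n :=
  (Iso.conjAut (D.baseIso h𝒢 n)).toMonoidHom.comp
    (CovObj.descendHom (D.g n) (D.W (n + 1)) h𝒢 (D.htrans n))

/-- The transition homomorphisms are surjective. [cite: MochizukiSemiAnbd2006, Prop 3.6 p.38] -/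
theorem step_surjective (n : ℕ) : Function.Surjective (D.step h𝒢 n) :=
  (Iso.conjAut (D.baseIso h𝒢 n)).surjective.comp
    (CovObj.descend_surjective (D.g n) (D.W (n + 1)) h𝒢 (D.htrans n) (D.htrans (n + 1)))

/-- The composite transition homomorphism `G_m → G_n` for `n ≤ m`. [cite: MochizukiSemiAnbd2006, Prop 3.6 p.38] -/
noncomputable def mapLE {n m : ℕ} (h : n ≤ m) : D.Gal h𝒢 m →* D.Gal h𝒢 n :=
  Nat.leRec (motive := fun m _ => D.Gal h𝒢 m →* D.Gal h𝒢 n) (MonoidHom.id _)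
    (fun k _ φ => φ.comp (D.step h𝒢 k)) h

/-- `mapLE (le_refl) = id`. [cite: MochizukiSemiAnbd2006, Prop 3.6 p.38] -/
theorem mapLE_self (n : ℕ) : D.mapLE h𝒢 (le_refl n) = MonoidHom.id _ :=
  Nat.leRec_self _ _

/-- `mapLE (n ≤ k+1) = mapLE (n ≤ k) ∘ step k`. [cite: MochizukiSemiAnbd2006, Prop 3.6 p.38] -/
theorem mapLE_succ {n k : ℕ} (h : n ≤ k) (h' : n ≤ k + 1) :
    D.mapLE h𝒢 h' = (D.mapLE h𝒢 h).comp (D.step h𝒢 k) :=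
  Nat.leRec_succ _ _ h

/-- Transitivity of the transition homomorphisms. [cite: MochizukiSemiAnbd2006, Prop 3.6 p.38] -/
theorem mapLE_trans {n m k : ℕ} (hnm : n ≤ m) (hmk : m ≤ k) (x : D.Gal h𝒢 k) :
    D.mapLE h𝒢 hnm (D.mapLE h𝒢 hmk x) = D.mapLE h𝒢 (hnm.trans hmk) x := by
  induction k, hmk using Nat.le_induction with
  | base => rw [mapLE_self]; rfl
  | succ k hmk ih =>
    rw [D.mapLE_succ h𝒢 hmk, D.mapLE_succ h𝒢 (hnm.trans hmk)]
    exact ih _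

/-- The transition homomorphisms are surjective. [cite: MochizukiSemiAnbd2006, Prop 3.6 p.38] -/
theorem mapLE_surjective {n m : ℕ} (h : n ≤ m) : Function.Surjective (D.mapLE h𝒢 h) := by
  induction m, h using Nat.le_induction with
  | base => rw [mapLE_self]; exact Function.surjective_id
  | succ k hk ih =>
    rw [D.mapLE_succ h𝒢 hk]
    exact ih.comp (D.step_surjective h𝒢 k)

/-- **The inverse system `(Gal(𝒢_{∞,n}/𝒢))_n`** of countable discrete groups with surjective
transition maps ([SemiAnbd] p. 38). [cite: MochizukiSemiAnbd2006, Prop 3.6 p.38] -/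
noncomputable def system : CountableDiscreteSystem.{u} where
  ι := ULift.{u} ℕ
  obj := fun i => D.Gal h𝒢 i.down
  countable := fun i => D.countable_Gal h𝒢 i.down
  map := fun _ _ h => D.mapLE h𝒢 h
  map_self := fun n x => by
    change D.mapLE h𝒢 (le_refl n.down) x = x
    rw [mapLE_self]; rfl
  map_map := fun _ _ _ hij hjk x => D.mapLE_trans h𝒢 hij hjk x
  map_surjective := fun _ _ h => D.mapLE_surjective h𝒢 h

/-- **The tempered fundamental group `π₁^temp(𝒢) := lim_n Gal(𝒢_{∞,n}/𝒢)`** (for the given Galois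
level data; [SemiAnbd] p. 38), a closed subgroup of `∏_n Gal(𝒢_{∞,n}/𝒢)` with the prodiscrete
topology. [cite: MochizukiSemiAnbd2006, Prop 3.6(i) p.38] -/
noncomputable def temperedPi : Type u := (D.system h𝒢).limit

/-- Group structure of `π₁^temp(𝒢)`. [cite: MochizukiSemiAnbd2006, Prop 3.6(i) p.38] -/
noncomputable instance : Group (D.temperedPi h𝒢) := inferInstanceAs (Group (D.system h𝒢).limit)

/-- Topology of `π₁^temp(𝒢)` (subspace of the product of the discrete `G_n`).
[cite: MochizukiSemiAnbd2006, Prop 3.6(i) p.38] -/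
noncomputable instance : TopologicalSpace (D.temperedPi h𝒢) :=
  inferInstanceAs (TopologicalSpace (D.system h𝒢).limit)

/-- `π₁^temp(𝒢)` is a topological group. [cite: MochizukiSemiAnbd2006, Prop 3.6(i) p.38] -/
instance : IsTopologicalGroup (D.temperedPi h𝒢) :=
  inferInstanceAs (IsTopologicalGroup (D.system h𝒢).limit)

/-- `π₁^temp(𝒢)` is second countable (a subspace of a countable product of countable discrete
groups). [cite: MochizukiSemiAnbd2006, Prop 3.6(i) p.38] -/
instance : SecondCountableTopology (D.temperedPi h𝒢) := by
  haveI : ∀ i : (D.system h𝒢).ι, SecondCountableTopology ((D.system h𝒢).obj i) := fun i => by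
    haveI : Countable ((D.system h𝒢).obj i) := D.countable_Gal h𝒢 i.down
    exact DiscreteTopology.secondCountableTopology_of_countable
  haveI : Countable (D.system h𝒢).ι := inferInstanceAs (Countable (ULift.{u} ℕ))
  haveI : SecondCountableTopology (∀ i : (D.system h𝒢).ι, (D.system h𝒢).obj i) := inferInstance
  exact inferInstanceAs (SecondCountableTopology ((D.system h𝒢).limit : Set (∀ i, (D.system h𝒢).obj i)))

/-- **Proposition 3.6 (i) for the constructed group: `π₁^temp(𝒢)` is tempered.**
[cite: MochizukiSemiAnbd2006, Prop 3.6(i) p.38] -/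
theorem isTempered_temperedPi : IsTempered (D.temperedPi h𝒢) :=
  IsTempered.of_limitPresentation (D.system h𝒢) (ContinuousMulEquiv.refl _)

/-- The projections `ρ_n : π₁^temp(𝒢) →* Gal(𝒢_{∞,n}/𝒢)` (the action of `π₁^temp` on `𝒢_{∞,n}`,
hence on its underlying tree `𝔾̃_n`). [cite: MochizukiSemiAnbd2006, Prop 3.6 p.38] -/
noncomputable def proj (n : ℕ) : D.temperedPi h𝒢 →* D.Gal h𝒢 n := (D.system h𝒢).proj ⟨n⟩

/-- The projections `ρ_n` are continuous (their kernels are open).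
[cite: MochizukiSemiAnbd2006, Prop 3.6 p.38] -/
theorem continuous_proj (n : ℕ) : Continuous (D.proj h𝒢 n) := (D.system h𝒢).continuous_proj ⟨n⟩

/-- Compatibility of the projections with the transition maps. [cite: MochizukiSemiAnbd2006, Prop 3.6 p.38] -/
theorem mapLE_proj {n m : ℕ} (h : n ≤ m) (x : D.temperedPi h𝒢) :
    D.mapLE h𝒢 h (D.proj h𝒢 m x) = D.proj h𝒢 n x :=
  x.2 (show (⟨n⟩ : ULift.{u} ℕ) ≤ ⟨m⟩ from h)

end GaloisLevelData

end ProfiniteSemiGraph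

end Literature.AnabelianGeometry.SemiGraphs
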